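import Summits.KontsevichZagierPeriods.KontsevichZagierPeriods.Theorems.SoloInformedToricBoxSplit
import HarnessLib

/-!
# RULE SPLIT at work: an edge point and the centre of the square

Solo programme `solo-KontsevichZagierPeriods-informed`, session s106 (DEN-calculus, 3).

Two denominators outside the reach of every vertex rule (ND / VERTEX / DIAG of
`SoloInformedToricDenCalculus` see only singularities at vertices of the cube):

* the EDGE point: `x₀ + (1 − 2x₁)²` vanishes on `[0,1]²` exactly at `(0, ½)`; one split at
  `x₁ = ½` (RULE SPLIT of `SoloInformedToricBoxSplit`) rescales the halves to `x₀ + (1 − x₁)²`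
  and `x₀ + x₁²`, vertex moves of the cube-nondegenerate `x₀ + x₁²`
  (`soloInformed_presentableDen_edgeDen`);
* the CENTRE: `(1 − 2x₀)² + (1 − 2x₁)²` vanishes exactly at the interior point `(½, ½)`; two
  splits at `½` give four quarters rescaling to vertex moves of `x₀² + x₁²`
  (`soloInformed_presentableDen_centreDen`).

Hence `[σ, P/Q]` is presentable (the cube crux `SoloInformedAyoubCubeResolutionCube` holds with
`k = 1`) for these `Q`, every numerator `P` and every `(0,1)² ⊆ σ ⊆ [0,1]²`.

References: M. Kontsevich, D. Zagier, *Periods* (2001) §1.2 rules (1a), (2).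
-/

noncomputable section

open scoped BigOperators
open MeasureTheory Set
open Literature.NumberTheory.Transcendental Literature.NumberTheory.Transcendental.KZ
open Literature.ModelTheory.ExponentialFields (IsSemialgebraic)

namespace Summit.KontsevichZagierPeriods.KontsevichZagierPeriods.Theorems

/-! ## Examples: an edge point and the centre of the square -/

/-- The edge-point denominator `x₀ + (1 − 2x₁)²`, vanishing on `[0,1]²` exactly at `(0, ½)`. -/
def soloInformedEdgeDen : MvPolynomial (Fin 2) ℚ :=
  MvPolynomial.X 0 + (1 - 2 * MvPolynomial.X 1) ^ 2

/-- The centre denominator `(1 − 2x₀)² + (1 − 2x₁)²`, vanishing exactly at `(½, ½)`. -/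
def soloInformedCentreDen : MvPolynomial (Fin 2) ℚ :=
  (1 - 2 * MvPolynomial.X 0) ^ 2 + (1 - 2 * MvPolynomial.X 1) ^ 2

/-- `x₀^{m+1} + x₁²` does not vanish on the open square. -/
theorem soloInformed_aeval_XPowAddSq_ne_zero (m : ℕ) (x : Fin 2 → ℝ)
    (hx : x ∈ soloInformedOpenCube 2) :
    MvPolynomial.aeval x
      (MvPolynomial.X 0 ^ (m + 1) + MvPolynomial.X 1 ^ 2 : MvPolynomial (Fin 2) ℚ) ≠ 0 := by
  simp only [map_add, map_pow, MvPolynomial.aeval_X]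
  exact (add_pos (pow_pos (hx 0).1 _) (pow_pos (hx 1).1 _)).ne'

/-- **EDGE POINT.**  `x₀ + (1 − 2x₁)²` is a presentable denominator: split at `x₁ = ½`; the
lower half rescales to `x₀ + (1 − x₁)²` (vertex move `x₁ ↦ 1 − x₁` to `x₀ + x₁²`), the upper
half to `x₀ + x₁²`, cube-nondegenerate. [this work] -/
theorem soloInformed_presentableDen_edgeDen : SoloInformedPresentableDen soloInformedEdgeDen := by
  have hA : SoloInformedPresentableDen
      (MvPolynomial.X 0 ^ (0 + 1) + MvPolynomial.X 1 ^ 2 : MvPolynomial (Fin 2) ℚ) :=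
    soloInformed_presentableDen_of_nondegenerate (soloInformed_cubeNondegenerate_XPowAddSq 0)
  have hA0 := soloInformed_aeval_XPowAddSq_ne_zero 0
  have h₁ : SoloInformedPresentableDen (soloInformedScaleSubst 1 0 (1 / 2) soloInformedEdgeDen) :=
    soloInformed_presentableDen_of_eq_vertexMove {1} hA hA0 fun x _ => by
      simp [soloInformedEdgeDen, soloInformed_aeval_scaleSubst, soloInformedScaleMove,
        soloInformedVertexMove]
  have h₂ : SoloInformedPresentableDen
      (soloInformedScaleSubst 1 (1 / 2) (1 - 1 / 2) soloInformedEdgeDen) :=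
    soloInformed_presentableDen_of_eq_vertexMove ∅ hA hA0 fun x _ => by
      simp [soloInformedEdgeDen, soloInformed_aeval_scaleSubst, soloInformedScaleMove,
        soloInformedVertexMove]
      ring
  refine soloInformed_presentableDen_of_split 1 (1 / 2) (by norm_num) (by norm_num)
    (fun x hx _ => ?_) h₁ h₂
  simp only [soloInformedEdgeDen, map_add, map_pow, map_sub, map_one, map_mul, map_ofNat,
    MvPolynomial.aeval_X]
  exact (add_pos_of_pos_of_nonneg (hx 0).1 (sq_nonneg _)).ne'

/-- **CENTRE.**  `(1 − 2x₀)² + (1 − 2x₁)²`, vanishing at the interior point `(½, ½)`, is a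
presentable denominator: split at `x₀ = ½`, then each half at `x₁ = ½`; the four quarters
rescale to `(1 − x₀)² + (1 − x₁)²`, `(1 − x₀)² + x₁²`, `x₀² + (1 − x₁)²`, `x₀² + x₁²`, i.e. to
vertex moves of the cube-nondegenerate `x₀² + x₁²`. [this work] -/
theorem soloInformed_presentableDen_centreDen :
    SoloInformedPresentableDen soloInformedCentreDen := by
  have hA : SoloInformedPresentableDen
      (MvPolynomial.X 0 ^ (1 + 1) + MvPolynomial.X 1 ^ 2 : MvPolynomial (Fin 2) ℚ) :=
    soloInformed_presentableDen_of_nondegenerate (soloInformed_cubeNondegenerate_XPowAddSq 1)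
  have hA0 := soloInformed_aeval_XPowAddSq_ne_zero 1
  have hsq : ∀ t : ℝ, t ≠ ((1 / 2 : ℚ) : ℝ) → (0 : ℝ) < (1 - 2 * t) ^ 2 := fun t ht =>
    (sq_nonneg _).lt_of_ne (pow_ne_zero 2 fun h => ht (by push_cast; linarith)).symm
  have hL : SoloInformedPresentableDen (soloInformedScaleSubst 0 0 (1 / 2) soloInformedCentreDen) := by
    refine soloInformed_presentableDen_of_split 1 (1 / 2) (by norm_num) (by norm_num)
      (fun x _ hne => ?_) ?_ ?_
    · have h : MvPolynomial.aeval x (soloInformedScaleSubst 0 0 (1 / 2) soloInformedCentreDen) =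
          (1 - x 0) ^ 2 + (1 - 2 * x 1) ^ 2 := by
        simp [soloInformedCentreDen, soloInformed_aeval_scaleSubst, soloInformedScaleMove]
      rw [h]
      exact (add_pos_of_nonneg_of_pos (sq_nonneg _) (hsq _ hne)).ne'
    · exact soloInformed_presentableDen_of_eq_vertexMove Finset.univ hA hA0 fun x _ => by
        simp [soloInformedCentreDen, soloInformed_aeval_scaleSubst, soloInformedScaleMove,
          soloInformedVertexMove]
    · exact soloInformed_presentableDen_of_eq_vertexMove {0} hA hA0 fun x _ => by
        simp [soloInformedCentreDen, soloInformed_aeval_scaleSubst, soloInformedScaleMove,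
          soloInformedVertexMove]
        ring
  have hH : SoloInformedPresentableDen
      (soloInformedScaleSubst 0 (1 / 2) (1 - 1 / 2) soloInformedCentreDen) := by
    refine soloInformed_presentableDen_of_split 1 (1 / 2) (by norm_num) (by norm_num)
      (fun x _ hne => ?_) ?_ ?_
    · have h : MvPolynomial.aeval x
          (soloInformedScaleSubst 0 (1 / 2) (1 - 1 / 2) soloInformedCentreDen) =
          x 0 ^ 2 + (1 - 2 * x 1) ^ 2 := by
        simp [soloInformedCentreDen, soloInformed_aeval_scaleSubst, soloInformedScaleMove]
        ring
      rw [h]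
      exact (add_pos_of_nonneg_of_pos (sq_nonneg _) (hsq _ hne)).ne'
    · exact soloInformed_presentableDen_of_eq_vertexMove {1} hA hA0 fun x _ => by
        simp [soloInformedCentreDen, soloInformed_aeval_scaleSubst, soloInformedScaleMove,
          soloInformedVertexMove]
        ring
    · exact soloInformed_presentableDen_of_eq_vertexMove ∅ hA hA0 fun x _ => by
        simp [soloInformedCentreDen, soloInformed_aeval_scaleSubst, soloInformedScaleMove,
          soloInformedVertexMove]
        ring
  refine soloInformed_presentableDen_of_split 0 (1 / 2) (by norm_num) (by norm_num)
    (fun x _ hne => ?_) hL hH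
  have h : MvPolynomial.aeval x soloInformedCentreDen = (1 - 2 * x 0) ^ 2 + (1 - 2 * x 1) ^ 2 := by
    simp [soloInformedCentreDen]
  rw [h]
  exact (add_pos_of_pos_of_nonneg (hsq _ hne) (sq_nonneg _)).ne'

end Summit.KontsevichZagierPeriods.KontsevichZagierPeriods.Theorems
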